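import Summits.BirchSwinnertonDyer.BirchSwinnertonDyer.Theorems.CongruentShaFreeCutKatoDescentDatumOfH2
import Literature.NumberTheory.EllipticCurves.Kato2004.AdmissibleZetaClass
import Literature.NumberTheory.EllipticCurves.KatoFineSelmerDualProofs
import HarnessLib

/-!
# CLOSED binders for the Kato descent interface: `IsKatoZetaDescentDatumOf W p D` (closed `IsOf`) and
# `KatoMainConjectureFine W p` (closed `KMC`, `@[conjecture]`) — hand-over of seat bsd-cm-prr-ty1 (T2a/T2b of
# planner D358 (R2)/D360; intended tree path `Summits/BirchSwinnertonDyer/Rank1Residual/Additive/KatoDescentClosedBinders.lean`,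
# to be landed VERBATIM by a prover row — the literature-prover's lane ends at `Literature/`); hand-over v2 (g2,
# 2026-08-28): DOCSTRINGS ONLY changed against v1 29ac002660b84a13 — the (H2) comparison is now cited from Kato's own
# (14.9.1)/(12.2.3)/12.5 (3) with its exact scope, one wrong bib key fixed; declarations and proofs byte-identical;
# v2.1 (g6, 2026-08-28): ERRATUM PARAGRAPH ONLY (CONVENTION Q, planner D401/D403/D405/D410) — declarations byte-identical

ERRATUM (v2.1, CONVENTION). Read from the tree's DEFINITIONS: `Λ` acts on `I : Kato2004.IwasawaH1Data W p κ γ` by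
`T = conj_γ − 1` with `conj_σ` the natural, covariant action `(σ·c)(h) = σ • c(σ⁻¹hσ)` (`IwasawaH1Data.proj_T_smul`,
`GaloisRepresentations.conjMap`) — Kato's structure on `𝐇¹(T)`, `1 + T ↦ γ` [§12.2 p. 220] — but on the constructed
dual fine Selmer datum `W.fineSelmerDualData κ hγ` used in §§1–2 below it acts by PRE-composition,
`(T·x)(s) = x(conj_γ s) − x(s)` (`FineSelmerDualData.toDual_T_smul`), i.e. `1 + T ↦ (x ↦ x ∘ conj_γ)` = the
CONTRAGREDIENT action of `γ⁻¹`; since Poitou–Tate duality (Galois-invariant pairing) carries Kato's natural action on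
`𝐇²(T_pW)₀` to the contragredient action on `X₀`, the key-`γ` datum of this file is `(X₀)^ι`
(`ι : T ↦ (1+T)⁻¹ − 1`; Greenberg 1989 pp. 101–102), NOT Kato's `𝐇²(T_pW)₀` structure. CONSEQUENTLY, contrary to the
sentences «IS Kato's Conj. 12.10» below: `KatoMainConjectureFine W p` as defined here = Kato's Conj. 12.10 composed with
`ι` on the `X₀` side = print ∧ «`char_Λ X₀(ℚ_∞)` is `ι`-symmetric prime by prime» (UNPRINTED; Greenberg 1989 Thm. 2 pairs
the fine condition with the relaxed one under `ι`), and §1's (H2) pins `P.J.H2` to the lengths of `𝐇²(T_pW)^ι`; every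
layer-`0` count is unaffected (`Γ`-invariants, `Γ`-coinvariants and `|char(0)|_p` agree on `M` and `M^ι`). The
PRINT-EXACT statements are the contragredient twins `IsKatoZetaDescentDatumOfContra` / `KatoMainConjectureFineContra` of
`KatoDescentClosedBindersContra.lean` (p628155; `X₀` keyed `γ⁻¹`), related to the present ones by
`KatoDescentClosedBindersContraBridge.lean` (p629405: `ContraBridge.katoMainConjectureFine_iff_contra_of_involSymmetric` —
equivalent iff that `ι`-symmetry; `ContraBridge.katoMainConjectureFineContra_iff_comap_invol` — the twin is this file's
formula read at `ι𝔮`). The declarations of this file are kept byte-identical (13 by-name importers; gate append-only).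
[cite: Kato2004Asterisque, §12.2 (p. 220), Conj. 12.10 (p. 224), (14.9.1) (p. 239), §17.13 (17.13.1) (p. 279)]
[cite: Greenberg1989, §0 pp. 101–102 (the Λ-module S^ι) and Thm. 2] [cite: GreenbergLNM1716, §1 p. 60]

WHAT. The descent files (`KatoDescentDatum.lean`, `KatoDescentRankOnePerrinRiou.lean`,
`KatoDescentTorsionFreeReadings.lean`, cells bsd-potss / bsd-cm) read every statement over three interface binders
`(IsOf, PRRatio, KMC)`. `PRRatio` is constructed (`Kato2004.PRRatio`, `Literature/…/Kato2004/PerrinRiouRatio.lean`).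
This file constructs the other two:

* §1 `IsKatoZetaDescentDatumOf W p D` := cn100's v2 pin `P : KatoDescentDatumPinH2 W p D` (`D.H`, `D.A`, `D.ι`, `D.π`
  ARE rkm's `𝐇¹_Γ(T_pW)`, `H¹(ℤ[1/p],T_pW)`, `proj₀`, (14.14.1)) **∧ (Z) `Kato2004.IsAdmissibleZetaClass W p P.κ
  P.isCyclotomic P.I (P.eH D.z)`** (`D.z` IS Kato's `Ω_W`-normalised zeta class up to `Λˣ`,
  `Literature/…/Kato2004/AdmissibleZetaClass.lean`) **∧ (H2) at every height-one `𝔮`,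
  `length (P.J.H2)_𝔮 = length (X₀)_𝔮`** with `X₀ := (W.fineSelmerDualData P.κ P.isTopGenerator).X` the
  CONSTRUCTED Pontryagin dual of the fine Selmer group `Sel₀(ℚ_∞, W[p^∞])` (`KatoFineSelmerDualProofs.lean`).
* §2 `KatoMainConjectureFine W p` := for every prime structure on `p`: (∃ an admissible class) ∧ ∀ cyclotomic
  `(K, γ)`, pinned `I : IwasawaH1Data W p K γ`, admissible `z₀ ∈ I.H`, and height-one `𝔮`:
  `length (X₀)_𝔮 = length (I.H/Λz₀)_𝔮` — Kato's Conj. 12.10 for `T_pW` on the `Δ`-trivial component, `p` odd, in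
  FINE-SELMER form (its integrality clause `Z(f,T)_𝔭 ⊂ 𝐇¹(T)_𝔭` is the ∃-conjunct), `@[conjecture]`, nothing asserted.
* §3 kernel lemmas: unfolding; `IsKatoZetaDescentDatumOf → IsKatoDescentDatumOfH2` (so every cn100 reading over the v2
  pin applies); `→ p ≠ 2`; **the `→` half of the interface reading `ReadsTrivialKMC`**:
  `IsKatoZetaDescentDatumOf W p D → KatoMainConjectureFine W p → D.Conj1210` (transport of lengths along `P.eH`,
  `P.eH2`); `¬ KatoMainConjectureFine W 2` (empty quantifier domain ∧ ∃-conjunct: the closed `KMC` is NOT vacuously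
  true at `2`).

WHY THE (H2) CLAUSE (D137 cooked-data audit, seat prr-ty1 2026-08-28 STATUS l.1818). `Kato2004.IwasawaH2Data.H2` is
ABSTRACT (finitely generated, torsion, (14.14.1) on its `T`-invariants only): `H2 ⊕ Λ/(T+p)` satisfies every field of
the v2 pin with a different characteristic ideal and `p` times the `T`-coinvariant order, so over the v2 pin alone a
closed `KMC := ∀ D, IsOf D → D.Conj1210` is refutable and `D.h2Card` is cookable. With (H2): the lengths of `D.H2` at
height-one primes are those of the CONSTRUCTED `X₀` (pinned), and since `D.H2[T] ≅ coker(D.ι)` is pinned by (14.14.1),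
`#(D.H2/T) = #D.H2[T] · |char_{X₀}(0)|_p⁻¹` is pinned whenever finite (multiplicativity of the `T`-Euler
characteristic `#coker/#ker` on finitely generated torsion `Λ`-modules, `= 1` on finite ones) — the count reading's
`D.h2Card` is no longer cookable.

PRINT FOR (H2) — `X₀(ℚ_∞)` versus Kato's `𝐇²(T_pW)⁰` (hand-over v2, seat prr-ty1 g2; resolves v1's `[cite pending]`,
all from Kato's own text). Kato's `𝐇^q(T) = lim_n H^q(ℤ[ζ_{p^n}][1/p], T)` is ÉTALE cohomology of `Spec ℤ[ζ_{p^n}][1/p]`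
with the convention `H^q(R, ·) := H^q(R, j_* ·)` (8.2, p. 180; 12.2 with (12.2.1)–(12.2.3), p. 220). His Poitou–Tate
sequence (14.9.1) [p. 239: EXACT for `p ≠ 2`, exact up to `×2` at `p = 2`], written for the layers `K = ℚ_n` of `ℚ_∞` and
`T = T_pW` (so `T*(1) ⊗ ℚ/ℤ = W[p^∞]`), read through the local Tate duality displayed on p. 239 and passed to `lim_n`
(all terms compact; Kato performs exactly this passage on (14.9.3) in (17.13.1), p. 279), yields the exact sequence of
`Λ`-modules **`0 → X₀(ℚ_∞) → 𝐇²(T_pW)⁰ → 𝐇²_loc(T_pW)⁰ → (W(ℚ_∞)[p^∞])^∨ → 0`**, where: `X₀(ℚ_∞)` is the Pontryagin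
dual of `ker(H¹(O_{ℚ_∞}[1/p], W[p^∞]) → H¹(ℚ_{∞,p}, W[p^∞]))` — classes unramified away from `p` and trivial at `p`,
which over `ℚ_∞` ARE the everywhere-locally-trivial classes of `fineSelmerInfty` (for `w ∤ p` the residue field of
`ℚ_{∞,w}` has absolute Galois group `∏_{ℓ ≠ p} ℤ_ℓ`, so `H¹_ur(ℚ_{∞,w}, W[p^∞]) = 0`); and
`𝐇²_loc(T_pW)⁰ = lim_n H²(ℚ_{n,p}, T_pW) ≅ (W(ℚ_{p,∞})[p^∞])^∨`, `ℚ_{p,∞}` the cyclotomic `ℤ_p`-extension of `ℚ_p`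
(local duality + Weil pairing; Kato's display after (12.2.3), p. 220: `𝐇²_loc(T) ≅ Hom(H⁰(ℚ_p(ζ_{p^∞}), Hom(T, ℚ/ℤ)), ℚ/ℤ)(−1)`).
HENCE `X₀(ℚ_∞) ↪ 𝐇²(T_pW)⁰` is INJECTIVE, its cokernel embeds in the finitely generated `ℤ_p`-module
`(W(ℚ_{p,∞})[p^∞])^∨`, and the two modules have EQUAL length at every height-one prime of `Λ` as soon as
`W(ℚ_{p,∞})[p^∞]` is finite. SCOPE (for `p` odd): finite whenever `W` is potentially good at `p` — Imai's theorem
[cite: Imai1975, Theorem (p. 12)] over a field of good reduction; this is the standing hypothesis `0 ≤ v_p(j W)` of EVERY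
reading in the Kato descent files and the case of every CM curve, in particular of all rows of 19945 (`𝒞₇ × {7}`) and
19223 (`(p, I₀*)`, `p ≥ 5`) — and whenever `W` is multiplicative at `p` (`μ_p ⊄ ℚ_{p,∞}`); it FAILS for `p` odd exactly
when `p = 3` and `W/ℚ_3` is the `ω`-twist of a Tate curve (additive, potentially multiplicative, split over `ℚ_3(√−3)`):
there `μ_{3^∞} ⊗ ω ⊂ W[3^∞]` is fixed by `G_{ℚ_{3,∞}}` (`κ` and `ω` agree on it, values `±1`), `𝐇²_loc(T_3W)⁰` has
`ℤ_3`-rank one and `𝐇²(T_3W)⁰` exceeds `X₀(ℚ_∞)` by length `1` at one height-one prime — Kato's exceptional case (12.5.1)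
of Thm. 12.5 (3) [p. 222, with Rem. 12.7: "`f` is not potentially of good reduction at `p`"] meeting the `Δ`-trivial
component. CONSEQUENCE: on every row where the readings are displayed (`0 ≤ v_p(j W)`), (H2) pins `P.J.H2` to the
lengths of Kato's genuine `𝐇²(T_pW)⁰` and `KatoMainConjectureFine W p` below IS Kato's Conj. 12.10 (trivial component,
fine-Selmer currency); at the exceptional `(W, 3)` it is NOT (off by that length-one term) — never display it there, as
at `p = 2`. Secondary print of the same Poitou–Tate mechanism in `G_S`-cohomology (fine Selmer dual `R(E/𝓛)^∨` inside
`H²_Iw(T_pE/𝓛)`, cokernel controlled by `⊕_{v ∈ S} K⁰_v(E/𝓛)^∨`): [cite: GhoshJhaShekhar2022, §1, the two displayed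
Poitou–Tate sequences over 𝓛 before "Here for i = 1,2" (arXiv p. 5), attributed there to Coates–Sujatha, Math. Ann. 331 (2005)].
The acquisitions acq-13793 (Kurihara 2002) / acq-13792 (Wuthrich 2007) filed by v1 are no longer needed for this sentence.
[cite: Kato2004Asterisque, 8.2 (p. 180), 12.2 (12.2.1)–(12.2.3) and the display after it (p. 220), (14.9.1) and the local duality display (p. 239), Thm. 12.5 (3) with (12.5.1) and Rem. 12.7 (p. 222), (17.13.1) (p. 279)]
[cite: PerrinRiou1995Asterisque, §1.3 and Appendix B (Kato's [Pe3]: weak Leopoldt, `𝐇²` torsion)]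

SOUNDNESS OF THE ∀ (print): admissible classes form ONE `Λˣ`-orbit (`AdmissibleZetaClass.lean` module docstring:
Kato Thm. 12.4 (2) + Rohrlich pin the value-pinned lift; the unit guard makes the multiplier a unit), `I` and `X₀` are
pinned up to unique isomorphism (`IwasawaH1Data.proj_injective/surjective`; `FineSelmerDualData.toDual` bijective with
`T = γ − 1`), so the ∀ ranges over isomorphic copies of ONE statement — Kato's 12.10 for `T_pW`, trivial component.
JUNK AUDIT (D137): `KMC := ⊤`-type junk is excluded by the ∃-conjunct (no admissible class ⇒ `KMC W p` FALSE, never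
vacuously true; in particular `¬ KMC W 2`); `IsOf := ⊥`-type junk: `IsKatoZetaDescentDatumOf` is realisable by PRINT
exactly where the readings `Realizable`/`RealizableOfKMC` say (Kato Thm. 12.4, 12.5 (4)/(12.5.2) or the integrality
clause, (14.14.1), `nonempty_iwasawaH1Data`, `nonempty_iwasawaH2Data`, (H2) above, guarded parameters); cooked data:
excluded by (Z) and (H2) as explained. Rows at which the UNIT GUARD of `AdmissibleZetaClass.lean` is unattainable
(every good `ℓ` anomalous for `p`) have `KMC W p` false for a non-mathematical reason — such rows must not display it
(none of 𝒞₇ × {7} / `(p, I₀*)`, `p ≥ 5`? — a per-row numerical check, NOT done here: planner's registration step).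

HONEST LABEL: two DEFINITIONS (one `@[conjecture]`) and kernel lemmas; no named fact, no instance, no notation, no
`sorry`; nothing about Kato's Main Conjecture, Perrin-Riou's conjecture or BSD is asserted; the readings
`ReadsTrivialKMC`, `RealizableOfKMC`, `RankOneCountReading`, `HasPRRatio` instantiated at
`(IsKatoZetaDescentDatumOf, Kato2004.PRRatio, KatoMainConjectureFine)` remain DISPLAYED print hypotheses of the
consumers (only the `→` half of `ReadsTrivialKMC` is proved here).
[cite: Kato2004Asterisque, Conj. 12.10 (p. 224), Thm. 12.4 (p. 221), Thm. 12.5 (4) (p. 222), §14.14 (14.14.1)–(14.14.2) (p. 243)]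
[cite: Kim2022StructureSelmer, §1.2.4 and Conj. 1.3] [cite: GreenbergLNM1716, §1 (after Conj. 1.3)]
-/

noncomputable section

open scoped Classical

open WeierstrassCurve Field Literature.NumberTheory.EllipticCurves
  Literature.NumberTheory.EllipticCurves.Kato2004 Literature.NumberTheory.EllipticCurves.IwasawaAlgebra
  Literature.NumberTheory.GaloisRepresentations
open Summit.BirchSwinnertonDyer.BirchSwinnertonDyer.Theorems.CongruentShaFreeCutKatoDescentDatumOfH2

namespace Summit.BirchSwinnertonDyer.Rank1Residual.Additive

/-! ## §1 The closed `IsOf` -/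

/-- **`IsKatoZetaDescentDatumOf W p D` — «`D` IS Kato's §14.14 descent datum of `T_pW` on the `Δ`-trivial component,
zeta element included»**: a v2 pin `P` (cn100) ∧ `P.eH D.z` is an ADMISSIBLE zeta class of `P.I` (prr-ty1) ∧ the
lengths of `P.J.H2` at height-one primes are those of the constructed dual fine Selmer module `X₀(ℚ_∞)` along
`(P.κ, P.γ)` — which ARE the lengths of Kato's genuine `𝐇²(T_pW)⁰` whenever `W(ℚ_{p,∞})[p^∞]` is finite, in
particular under the readings' standing hypothesis `0 ≤ v_p(j W)` (module docstring, PRINT FOR (H2): Kato (14.9.1) +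
(12.2.3) + Imai — ERRATUM v2.1: the datum used here is keyed `γ`, i.e. `(X₀)^ι`, so this clause pins the lengths of
`𝐇²(T_pW)^ι`; the print-exact twin is `IsKatoZetaDescentDatumOfContra`). The instance of the interface binder `IsOf`.
A `Prop`; nothing asserted.
[cite: Kato2004Asterisque, Thm. 12.4 (p. 221), Conj. 12.10 (p. 224), §14.14 (14.14.1) (p. 243), §12.2 (12.2.3) (p. 220), (14.9.1) (p. 239)]
[cite: Imai1975, Theorem (p. 12)] -/
def IsKatoZetaDescentDatumOf (W : WeierstrassCurve ℚ) [W.IsElliptic] [W.IsGloballyMinimal] (p : ℕ) [Fact p.Prime]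
    (D : KatoDescentDatum p) : Prop :=
  letI : ContinuousSMul ℤ_[p] (W.tateModule p) := TateModule.continuousSMul_padicInt
  ∃ P : KatoDescentDatumPinH2 W p D,
    Kato2004.IsAdmissibleZetaClass W p P.κ P.isCyclotomic P.I (P.eH D.z) ∧
    ∀ 𝔮 : PrimeSpectrum (IwasawaAlgebra p), 𝔮.asIdeal.height = 1 →
      Module.lengthAt (IwasawaAlgebra p) P.J.H2 𝔮 =
        Module.lengthAt (IwasawaAlgebra p) (W.fineSelmerDualData P.κ P.isTopGenerator).X 𝔮

/-! ## §2 The closed `KMC` (Kato's Conj. 12.10 for `T_pW`, trivial component, fine-Selmer form) -/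

/-- **`KatoMainConjectureFine W p` — Kato's Main Conjecture 12.10 for `T = T_pW` on the `Δ`-trivial component, `p`
odd, in FINE-SELMER currency, CLOSED**: (∃ an admissible zeta class — the integrality clause `Z(f,T)_𝔭 ⊂ 𝐇¹(T)_𝔭`)
∧ for every cyclotomic `(K, γ)`, pinned `𝐇¹_Γ(T_pW)` `I`, admissible `z₀ ∈ I.H` and height-one `𝔮`:
`length_{Λ_𝔮} X₀(ℚ_∞)_𝔮 = length_{Λ_𝔮} (𝐇¹_Γ/Λz₀)_𝔮` (Kato: `length 𝐇²(T)_𝔭 = length (𝐇¹(T)/Z(f,T))_𝔭`; `𝐇²(T_pW)⁰`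
and `X₀(ℚ_∞)` have the same lengths, module docstring). Binder type of the interface `KMC` (no `Fact p.Prime`):
the prime structure is quantified. The instance of the interface binder `KMC`. SCOPE: this closed statement IS Kato's
12.10 (trivial component) whenever `W(ℚ_{p,∞})[p^∞]` is finite — always under the readings' hypothesis `0 ≤ v_p(j W)`
(Imai) and for `W` multiplicative at `p` — and is NOT at `p = 2` (false by the ∃-conjunct) nor at `p = 3` with `W/ℚ_3`
the `ω`-twist of a Tate curve (Kato (12.5.1): `𝐇²(T_3W)⁰` exceeds `X₀(ℚ_∞)` by length one at one height-one prime;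
module docstring) — rows of those two kinds must not display it. ERRATUM v2.1 (module docstring CONVENTION): `X₀` enters
here keyed `γ`, i.e. as `(X₀)^ι`, so this statement is Kato's 12.10 ∘ `ι` on the `X₀` side — equivalent to 12.10 iff
`char_Λ X₀(ℚ_∞)` is `ι`-symmetric (unprinted); the print-exact twin is `KatoMainConjectureFineContra`
(`ContraBridge.katoMainConjectureFine_iff_contra_of_involSymmetric`). CONJECTURE (theorem for `p ∤ 2N·…` in many cases:
Kato Thm. 12.5 (4) divisibility + Skinner–Urban / Wan / BSTW converses — NOT at an additive `p`); `@[conjecture]`;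
nothing asserted. [cite: Kato2004Asterisque, Conj. 12.10 (p. 224), (14.9.1) (p. 239), Thm. 12.5 (3) with (12.5.1) (p. 222)]
[cite: Kim2022StructureSelmer, Conj. 1.3] [cite: Imai1975, Theorem (p. 12)] -/
@[conjecture] def KatoMainConjectureFine (W : WeierstrassCurve ℚ) [W.IsElliptic] [W.IsGloballyMinimal]
    (p : ℕ) : Prop :=
  ∀ hp : p.Prime,
    haveI : Fact p.Prime := ⟨hp⟩
    letI : ContinuousSMul ℤ_[p] (W.tateModule p) := TateModule.continuousSMul_padicInt
    (∃ (K : ZpExtension ℚ p) (hK : K.IsCyclotomic) (γ : absoluteGaloisGroup ℚ) (_ : K.IsTopGenerator γ)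
        (I : IwasawaH1Data W p K γ) (z₀ : I.H), Kato2004.IsAdmissibleZetaClass W p K hK I z₀) ∧
    ∀ (K : ZpExtension ℚ p) (hK : K.IsCyclotomic) (γ : absoluteGaloisGroup ℚ) (hγ : K.IsTopGenerator γ)
      (I : IwasawaH1Data W p K γ) (z₀ : I.H), Kato2004.IsAdmissibleZetaClass W p K hK I z₀ →
      ∀ 𝔮 : PrimeSpectrum (IwasawaAlgebra p), 𝔮.asIdeal.height = 1 →
        Module.lengthAt (IwasawaAlgebra p) (W.fineSelmerDualData K hγ).X 𝔮 =
          Module.lengthAt (IwasawaAlgebra p) (I.H ⧸ (IwasawaAlgebra p) ∙ z₀) 𝔮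

/-! ## §3 Kernel lemmas -/

section Lemmas

-- The `ContinuousSMul ℤ_[p] (T_pW)` structure fact is `Prop`-valued: the section binder below and the term
-- `TateModule.continuousSMul_padicInt` fixed inside the closed definitions agree by proof irrelevance.
variable {W : WeierstrassCurve ℚ} [W.IsElliptic] [W.IsGloballyMinimal] {p : ℕ} [Fact p.Prime]
  [ContinuousSMul ℤ_[p] (W.tateModule p)] {D : KatoDescentDatum p}

/-- Unfolding of the closed `IsOf` (under any instance of the `Prop`-valued structure fact).
[cite: Kato2004Asterisque, §14.14 (14.14.1) (p. 243)] -/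
theorem isKatoZetaDescentDatumOf_iff :
    IsKatoZetaDescentDatumOf W p D ↔
      ∃ P : KatoDescentDatumPinH2 W p D,
        Kato2004.IsAdmissibleZetaClass W p P.κ P.isCyclotomic P.I (P.eH D.z) ∧
        ∀ 𝔮 : PrimeSpectrum (IwasawaAlgebra p), 𝔮.asIdeal.height = 1 →
          Module.lengthAt (IwasawaAlgebra p) P.J.H2 𝔮 =
            Module.lengthAt (IwasawaAlgebra p) (W.fineSelmerDualData P.κ P.isTopGenerator).X 𝔮 :=
  Iff.rfl

/-- A witness gives the closed `IsOf` (any instance). [cite: Kato2004Asterisque, §14.14 (14.14.1) (p. 243)] -/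
theorem isKatoZetaDescentDatumOf_of_pin (P : KatoDescentDatumPinH2 W p D)
    (hz : Kato2004.IsAdmissibleZetaClass W p P.κ P.isCyclotomic P.I (P.eH D.z))
    (hH2 : ∀ 𝔮 : PrimeSpectrum (IwasawaAlgebra p), 𝔮.asIdeal.height = 1 →
      Module.lengthAt (IwasawaAlgebra p) P.J.H2 𝔮 =
        Module.lengthAt (IwasawaAlgebra p) (W.fineSelmerDualData P.κ P.isTopGenerator).X 𝔮) :
    IsKatoZetaDescentDatumOf W p D :=
  isKatoZetaDescentDatumOf_iff.mpr ⟨P, hz, hH2⟩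

omit [ContinuousSMul ℤ_[p] (W.tateModule p)] in
/-- The closed `IsOf` refines cn100's v2 pin: every reading proved over `IsKatoDescentDatumOfH2` applies.
[cite: Kato2004Asterisque, §14.14 (14.14.1) (p. 243)] -/
theorem IsKatoZetaDescentDatumOf.isKatoDescentDatumOfH2 (h : IsKatoZetaDescentDatumOf W p D) :
    IsKatoDescentDatumOfH2 W p D := by
  obtain ⟨P, -, -⟩ := h
  exact ⟨P⟩

omit [ContinuousSMul ℤ_[p] (W.tateModule p)] in
/-- The closed `IsOf` forces `p ≠ 2`. [cite: Kato2004Asterisque, Thm. 12.5 (4) (p. 222) (`p ≠ 2`)] -/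
theorem IsKatoZetaDescentDatumOf.ne_two (h : IsKatoZetaDescentDatumOf W p D) : p ≠ 2 := by
  letI : ContinuousSMul ℤ_[p] (W.tateModule p) := TateModule.continuousSMul_padicInt
  obtain ⟨P, hz, -⟩ := h
  exact Kato2004.ne_two_of_isAdmissibleZetaClass hz

omit [ContinuousSMul ℤ_[p] (W.tateModule p)] in
/-- **The `→` half of the interface reading `ReadsTrivialKMC` at the closed binders, KERNEL:** on a datum realising
the closed `IsOf`, the closed `KMC` gives Kato's Conj. 12.10 for the datum (`D.Conj1210`): apply the ∀-clause to the
datum's own `(P.κ, P.γ, P.I, P.eH D.z)` and transport lengths along `P.eH2 : D.H2 ≃ P.J.H2` and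
`D.H/ΛD.z ≃ P.I.H/Λ(P.eH D.z)`. [cite: Kato2004Asterisque, Conj. 12.10 (p. 224)] -/
theorem conj1210_of_isKatoZetaDescentDatumOf_of_katoMainConjectureFine (h : IsKatoZetaDescentDatumOf W p D)
    (hKMC : KatoMainConjectureFine W p) : D.Conj1210 := by
  letI : ContinuousSMul ℤ_[p] (W.tateModule p) := TateModule.continuousSMul_padicInt
  obtain ⟨P, hz, hH2⟩ := h
  obtain ⟨-, hall⟩ := hKMC Fact.out
  intro 𝔮 h𝔮
  have h1 := hall P.κ P.isCyclotomic P.γ P.isTopGenerator P.I (P.eH D.z) hz 𝔮 h𝔮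
  have hmap : ((IwasawaAlgebra p) ∙ D.z).map (P.eH : D.H →ₗ[IwasawaAlgebra p] P.I.H) =
      (IwasawaAlgebra p) ∙ (P.eH D.z) := by
    rw [Submodule.map_span, Set.image_singleton]; rfl
  have e₁ : (D.H ⧸ (IwasawaAlgebra p) ∙ D.z) ≃ₗ[IwasawaAlgebra p] (P.I.H ⧸ (IwasawaAlgebra p) ∙ (P.eH D.z)) :=
    Submodule.Quotient.equiv _ _ P.eH hmap
  rw [Module.lengthAt_eq_of_linearEquiv P.eH2 𝔮, Module.lengthAt_eq_of_linearEquiv e₁ 𝔮, hH2 𝔮 h𝔮, h1]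

/-- **The closed `KMC` is NOT vacuously true at `p = 2`** (its quantifier domain is empty there AND it carries the
∃-conjunct): `¬ KatoMainConjectureFine W 2`. Rows at `p = 2` must not display it.
[cite: Kato2004Asterisque, Conj. 12.10 (p. 224) (`𝔭 ∌ 2`)] -/
theorem not_katoMainConjectureFine_two (W : WeierstrassCurve ℚ) [W.IsElliptic] [W.IsGloballyMinimal] :
    ¬ KatoMainConjectureFine W 2 := by
  intro h
  haveI : Fact (Nat.Prime 2) := ⟨Nat.prime_two⟩
  letI : ContinuousSMul ℤ_[2] (W.tateModule 2) := TateModule.continuousSMul_padicInt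
  obtain ⟨⟨K, hK, γ, _, I, z₀, hz⟩, -⟩ := h Nat.prime_two
  exact Kato2004.not_isAdmissibleZetaClass_two W K hK I z₀ hz

end Lemmas

end Summit.BirchSwinnertonDyer.Rank1Residual.Additive

end
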